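import Literature.NumberTheory.EllipticCurves.PadicPointsFiltrationProofs
import Literature.NumberTheory.EllipticCurves.Tamagawa
import Literature.NumberTheory.EllipticCurves.ManinConstantAdditivePrimesProofs
import Literature.NumberTheory.EllipticCurves.GlobalMinimalModel
import HarnessLib

/-!
# Class O1 (X5, `p = 2`, non-CM): LEMMA ι — the Néron local index of the `2`-adic logarithm, TYPED
# (item (17) `localIndexAtTwo_eq` of the o1 lead's typer queue v3.2; lens-3 L3-14 (D4), G8.4 (ι-E))

HONEST FRAMING (cell `b2b-bsdres`, run/shared/lean/b2b/bsd-rank1-residual/, verbatim in every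
file): the goal of the cell is to DELETE the COMBINATION-SHAPED residual classes of the
Birch–Swinnerton-Dyer formula for ALL analytic-rank `≤ 1` elliptic curves over `ℚ` — "full BSD
formula for every rank `≤ 1` curve in class `C`" assembled STRICTLY from published theorems — so
that the rank-`≤ 1` remainder becomes exactly the CONSTRUCTION-SHAPED classes, which are TYPED
(missing-input `Prop`s), NOT attempted. This is not "finishing BSD". Research routes; no claim
beyond stated classes; census output = EVIDENCE, never a Literature fact; nothing here is booked;
no mark of RESIDUAL-MAP §I moves.

Unit `b2b-bsdres-cc-typer-4` (lane CLASS-CLOSURE, class O1), gen 4. ONE typed slot (a PROVABLE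
lemma, size S–M, NOT proved here, NOT asserted), one auxiliary integer, and the PROVED bottom level of
the filtration it counts (three small theorems). 0 named facts.

## LEMMA ι (lens-3 `cells/o1/ROUTES-O1.md` §lens-3 GEN 7 (D4) l.1364, GEN 8 G8.4 (ι-E); refuter
## REFUTER-O1 v8 §35 J3 PASS; lead D23 re-derivation; PLAN C104 (17) "MAY PROCEED NOW")

For `E/ℚ₂` given by a MINIMAL Weierstrass model with Néron differential `ω`, let
`𝔩₂(E) := log_ω(E(ℚ₂)) ⊂ ℚ₂` (the logarithm extended to all of `E(ℚ₂)` by `log P = (1/m)·log(mP)`),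
`2^{t₂} := #E(ℚ₂)[2^∞]`, `c₂ := [E(ℚ₂) : E₀(ℚ₂)]`, `Ẽ_ns(𝔽₂)` the nonsingular points of the reduction.
Then
  **`v₂(𝔩₂(E)) = 1 + t₂ − v₂(c₂) − v₂(#Ẽ_ns(𝔽₂))`.**
Proof in words (six lines, uniform in `p`; lead D23 §2): `E ⊇ E₀ ⊇ E₁ = Ê(2ℤ₂) ⊇ E₂ = Ê(4ℤ₂)` with
indices `c₂`, `#Ẽ_ns(𝔽₂)` (AEC VII.2.1 + C.15), `2` (AEC IV.3.2 (a)); `log : Ê(4ℤ₂) ≅ 4ℤ₂`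
(AEC IV.6.4 (b), `r = 2 > v(2)/(2−1)`), so `Ê(4ℤ₂)` is torsion-free and `log` kills exactly the
(finite) torsion; counting `[E(ℚ₂) : Ê(4ℤ₂)] = 2·c₂·#Ẽ_ns(𝔽₂)` through `log` gives
`[𝔩₂ : 4ℤ₂] = 2·c₂·#Ẽ_ns(𝔽₂)/#E(ℚ₂)_tors` and the display (odd parts cancel). At an additive `2`
(`#Ẽ_ns = 2`): `v₂(𝔩₂) = t₂ − v₂(c₂)`; at a good supersingular `2` (`#Ẽ(𝔽₂)` odd, `c₂ = 1`):
`v₂(𝔩₂) = 1 + t₂`. The Kosters–Pannekoek exceptional bit (`E₀(ℚ₂) ≅ ℤ₂ × ℤ/2` iff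
`a₁ + a₃ ≡ 2 (mod 4)` in their normal form, arXiv:1703.07888 Cor. 2) needs NO separate case: it is
absorbed in `t₂` (G8.4). Role in L3-14: Kato's local index `ν` of Prop. 14.16 at `p = 2` without
Fontaine–Laffaille (D4); what it saves is `v₂(c₂)`.

EVIDENCE (never an input here): lens-3's P-ι dry measurement G8.1 — an exact `2`-adic engine with
completeness certificates finds `min_P v₂(log_ω P)` = the predicted exponent on 5 293 / 5 295 O1
classes (2 NOPRED: `t₂` missing), 5 295 / 5 295 at the `E₀`-level; the registered run is the census
lane's (census-lead G-23).

## The Lean spelling (all vocabulary is the tree's)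

For the globally minimal `W/ℚ` (`[W.IsGloballyMinimal]`), `W₂ := W.map (algebraMap ℚ ℚ_[2])` is
`ℤ₂`-minimal (`isMinimal_map_padic_of_isGloballyMinimal`, hence `ℤ₂`-integral), so its invariant
differential is the Néron differential and the tree's LIMIT LOGARITHM
`W₂.padicLimitLog P = lim_k z(2ᵏP)/2ᵏ` (`PadicPointsFiltration.lean`; `z = −x/y`; `= log_ω` on
`E₁(ℚ₂)` by AEC IV.6.4, and the extension by division elsewhere) is `log_ω` on ALL of `E(ℚ₂)`.
`t₂ = v₂ #(AddCommGroup.primaryComponent E(ℚ₂) 2)`; `c₂ = W₂.localTamagawaNumber ℤ_[2]`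
(`Tamagawa.lean`: the index `[E(ℚ₂) : E₀(ℚ₂)]` on a `ℤ₂`-minimal model); `#Ẽ_ns(𝔽₂) =
reductionPointCount W 2` (`GlobalMinimalModel.lean`: `Nat.card` of the points of the reduction of
the integral model mod `2` — Mathlib's `Point` type consists of the NONSINGULAR affine points and `O`).
`v₂(𝔩₂) = e` is spelled "`‖log P‖ ≤ 2^{−e}` for all `P` and `= 2^{−e}` for some `P`" (the image is a
`ℤ₂`-module, so this is the same as `𝔩₂ = 2^e ℤ₂`; it is also literally what P-ι measures).

* `localLogIndexExponentAtTwo W : ℤ` — `e(W) := 1 + t₂ − v₂(c₂) − v₂(#Ẽ_ns(𝔽₂))`.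
* **`LocalLogIndexAtTwo W : Prop`** — LEMMA ι (ι-E) for `W` (register name `localIndexAtTwo_eq`;
  TYPED, PROVABLE, not asserted; its discharge `theorem localLogIndexAtTwo_holds` is a Literature-scale
  job: the missing tree inputs are `E₀/E₁ ≅ Ẽ_ns(𝔽₂)` (AEC VII.2.1; the tree's
  `mem_goodReductionSubgroup_iff` is still a named fact), `[E : E₀] = c₂` finite (Tate's algorithm /
  AEC C.15) and `E₁/E₂ ≅ 𝔽₂`; the bottom level `log : E₂ ≅ 4ℤ₂` IS in the tree and is recorded below).
* `norm_padicLimitLog_le_of_mem_formalFiltration_two`, `exists_mem_formalFiltration_two_norm_padicLimitLog_eq`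
  (PROVED, any `ℤ₂`-integral model `V/ℚ₂`) — `v₂(log_ω E⁽²⁾(ℚ₂)) = 2` exactly: the `n = 2` case of the
  tree's `norm_padicLimitLog_of_mem` / `exists_mem_padicLimitLog_eq` (AEC IV.6.4 (b) transported by
  VII.2.2); `localLogIndexExponentAtTwo_le_two` (PROVED) — hence `LocalLogIndexAtTwo W → e(W) ≤ 2`.

References: Silverman, *AEC* 2nd ed. (2009), IV.3.2 (a), IV.6.4 (b), VII.2.1–2.2, VII.6.3, C.15–C.16
[SilvermanAEC2009]; M. Kosters, R. Pannekoek, arXiv:1703.07888, Cor. 2 [corpus:paper:arxiv-1703.07888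
p. 3]; K. Kato, Astérisque 295 (2004), Prop. 14.16–14.18 [Kato2004Asterisque].
-/

set_option autoImplicit false

noncomputable section

open scoped Classical

open WeierstrassCurve Literature.NumberTheory.EllipticCurves

namespace Summit.BirchSwinnertonDyer.Rank1Residual.X5.O1

variable (W : WeierstrassCurve ℚ) [W.IsElliptic] [W.IsGloballyMinimal]

/-! ## §1 The exponent and the typed slot -/

omit [W.IsElliptic] in
/-- **The LEMMA ι exponent `e(W) := 1 + t₂ − v₂(c₂) − v₂(#Ẽ_ns(𝔽₂))`** at `2` for the globally minimal
`W`: `t₂ = v₂ #E(ℚ₂)[2^∞]` (the `2`-primary component of `E(ℚ₂) = (W.map (algebraMap ℚ ℚ_[2])).Point`;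
junk `v₂ 0 = 0` if it were infinite — it is not: `E(ℚ₂)_tors` is finite), `c₂ =` the local Tamagawa
number of `W/ℚ₂` (`localTamagawaNumber ℤ_[2]`), `#Ẽ_ns(𝔽₂) = reductionPointCount W 2`. Predicted
values on the O1 census (lens-3 G8.1, EVIDENCE): additive `{1: 811, 0: 909, −1: 215, −2: 10}`, good
supersingular `{1: 763}`. [cite: SilvermanAEC2009, IV.6.4 (b), VII.2.1 and C.15–C.16] -/
def localLogIndexExponentAtTwo : ℤ :=
  1 + (padicValNat 2 (Nat.card
        (AddCommGroup.primaryComponent (W.map (algebraMap ℚ ℚ_[2])).toAffine.Point 2)) : ℤ)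
    - (padicValNat 2 ((W.map (algebraMap ℚ ℚ_[2])).localTamagawaNumber ℤ_[2]) : ℤ)
    - (padicValNat 2 (reductionPointCount W 2) : ℤ)

/-- **LEMMA ι (ι-E), TYPED (register name `localIndexAtTwo_eq`; PROVABLE, size S–M; NOT asserted):
`v₂(log_ω E(ℚ₂)) = 1 + t₂ − v₂(c₂) − v₂(#Ẽ_ns(𝔽₂))` on the minimal model** — spelled with the tree's
limit logarithm `padicLimitLog` of `W₂ = W.map (algebraMap ℚ ℚ_[2])` (`ℤ₂`-minimal by
`isMinimal_map_padic_of_isGloballyMinimal`, so `ω` is the Néron differential): every `log_ω P`,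
`P ∈ E(ℚ₂)`, has `‖log_ω P‖₂ ≤ 2^{−e(W)}`, with equality for some `P`. Inputs of the (unwritten)
proof: AEC IV.3.2 (a), IV.6.4 (b), VII.2.1–2.2, C.15; Kosters–Pannekoek Cor. 2 only to READ `t₂` off an
additive model. Consumed by L3-14's `O1.KatoHTwoBoundAtTwo`-line (item (20), not yet typed) as Kato's
`ν` at `2`. [cite: SilvermanAEC2009, IV.6.4 (b), VII.2.1–2.2 and C.15–C.16]
[cite: Kato2004Asterisque, Prop. 14.16–14.18] -/
def LocalLogIndexAtTwo : Prop :=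
  haveI := isMinimal_map_padic_of_isGloballyMinimal W 2
  (∀ P : (W.map (algebraMap ℚ ℚ_[2])).toAffine.Point,
      ‖(W.map (algebraMap ℚ ℚ_[2])).padicLimitLog P‖ ≤ (2 : ℝ) ^ (-localLogIndexExponentAtTwo W)) ∧
  ∃ P : (W.map (algebraMap ℚ ℚ_[2])).toAffine.Point,
      ‖(W.map (algebraMap ℚ ℚ_[2])).padicLimitLog P‖ = (2 : ℝ) ^ (-localLogIndexExponentAtTwo W)

/-! ## §2 The bottom level of the filtration (PROVED, in the same spelling; any `2`-integral model) -/

section Level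

variable (V : WeierstrassCurve ℚ_[2]) [V.IsIntegral ℤ_[2]] [V.IsElliptic]

/-- **`‖log_ω P‖₂ ≤ 2⁻²` on `E⁽²⁾(ℚ₂) = Ê(4ℤ₂)`** (PROVED, any `ℤ₂`-integral model `V`): the `n = 2` case
of the tree's `norm_padicLimitLog_of_mem` (`‖L(P)‖ = ‖z(P)‖`) and the defining bound `‖z(P)‖ ≤ 2⁻²`
of `formalFiltration 2`. [cite: SilvermanAEC2009, IV.6.4 (b) and VII.2.2] -/
theorem norm_padicLimitLog_le_of_mem_formalFiltration_two {P : V.toAffine.Point}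
    (hP : P ∈ V.formalFiltration 2) : ‖V.padicLimitLog P‖ ≤ (2 : ℝ) ^ (-(2 : ℤ)) := by
  rw [V.norm_padicLimitLog_of_mem le_rfl hP]
  have h := hP.2
  have h4 : (((2 : ℕ) : ℝ)⁻¹) ^ 2 = (2 : ℝ) ^ (-(2 : ℤ)) := by norm_num
  rw [← h4]
  exact h

/-- **`log_ω` maps `E⁽²⁾(ℚ₂)` ONTO `4ℤ₂`; in particular some `P ∈ E⁽²⁾(ℚ₂)` has `‖log_ω P‖₂ = 2⁻²`**
(PROVED, any `ℤ₂`-integral model `V`): the tree's `exists_mem_padicLimitLog_eq` at `n = 2`, `t = 4`.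
With the previous lemma: `v₂(log_ω E⁽²⁾(ℚ₂)) = 2` — the bottom rung of LEMMA ι's index count.
[cite: SilvermanAEC2009, IV.6.4 (b) and VII.6.3] -/
theorem exists_mem_formalFiltration_two_norm_padicLimitLog_eq :
    ∃ P ∈ V.formalFiltration 2, ‖V.padicLimitLog P‖ = (2 : ℝ) ^ (-(2 : ℤ)) := by
  have h2 : ‖(2 : ℚ_[2])‖ = (2 : ℝ)⁻¹ := by
    have h := Padic.norm_p (p := 2)
    simpa using h
  have ht : ‖(4 : ℚ_[2])‖ ≤ (((2 : ℕ) : ℝ)⁻¹) ^ 2 := by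
    rw [show (4 : ℚ_[2]) = (2 : ℚ_[2]) ^ 2 by norm_num, norm_pow, h2]
    norm_num
  obtain ⟨Q, hQ, hQt⟩ := V.exists_mem_padicLimitLog_eq le_rfl ht
  refine ⟨Q, hQ, ?_⟩
  rw [hQt, show (4 : ℚ_[2]) = (2 : ℚ_[2]) ^ 2 by norm_num, norm_pow, h2]
  norm_num

end Level

/-- **The bottom rung for the globally minimal `W` itself** (PROVED): some `P ∈ E⁽²⁾(ℚ₂)` of
`W.map (algebraMap ℚ ℚ_[2])` has `‖log_ω P‖₂ = 2⁻²`, so the exponent of LEMMA ι is `≤ 2` whenever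
`LocalLogIndexAtTwo W` holds (`2^{−e} ≥ 2^{−2}`). [cite: SilvermanAEC2009, IV.6.4 (b) and VII.6.3] -/
theorem localLogIndexExponentAtTwo_le_two (h : LocalLogIndexAtTwo W) :
    localLogIndexExponentAtTwo W ≤ 2 := by
  haveI := isMinimal_map_padic_of_isGloballyMinimal W 2
  obtain ⟨P, hP, hPn⟩ :=
    exists_mem_formalFiltration_two_norm_padicLimitLog_eq (W.map (algebraMap ℚ ℚ_[2]))
  have hle := h.1 P
  rw [hPn] at hle
  by_contra hlt
  have hlt' : 2 < localLogIndexExponentAtTwo W := not_le.mp hlt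
  have : (2 : ℝ) ^ (-localLogIndexExponentAtTwo W) < (2 : ℝ) ^ (-(2 : ℤ)) :=
    zpow_lt_zpow_right₀ (by norm_num) (by omega)
  exact absurd hle (not_le.mpr this)

/-! ## §3 ERRATUM to §1 and the corrected slot: the logarithm EXTENDED BY DIVISION

(cc-typer-4 GEN 5.) The tree's `padicLimitLog P = lim_k z(2ᵏP)/2ᵏ` is a `limUnder`: it is the Néron
logarithm `log_ω P` exactly when the sequence converges, which happens iff some `2ᵃP` lies in
`E⁽²⁾(ℚ₂)` (then `L(P) = 2^{−a}L(2ᵃP)`), i.e. iff the image of `P` in the finite group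
`E(ℚ₂)/E⁽²⁾(ℚ₂)` (order `m = [E(ℚ₂) : E⁽²⁾(ℚ₂)] = 2·c₂·#Ẽ_ns(𝔽₂)`, the tree's
`WeierstrassCurve.index_formalFiltration`) has `2`-power order; for the other points (they exist as
soon as `m` is not a power of `2`: good supersingular `a₂ ∈ {0, −2}`, i.e. `#Ẽ(𝔽₂) ∈ {3, 5}`, and
additive `c₂ = 3`) the multiples `2ᵏP` accumulate at non-zero odd-order torsion points, the
sequence `z(2ᵏP)/2ᵏ` does not converge to `log_ω P` (it is unbounded whenever those torsion points
have `x ≠ 0`, the generic case), and `padicLimitLog P` is then the JUNK value of a non-convergent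
`limUnder` (an unknowable constant) or an unrelated limit. Hence the §1 slot `LocalLogIndexAtTwo W`,
which bounds `‖padicLimitLog P‖` for ALL `P`, does not say what was intended on those classes and is
not provable there as stated (its truth value depends on the junk constant) — it is the intended
statement only when `m` is a power of `2`. The intended statement (lens-3 (D4)/(ι-E), lead D23: "`log` extended to
all of `E(ℚ₂)` by `log P = (1/m)·log(mP)`") is re-typed below with the logarithm EXTENDED BY DIVISION,
`padicLogDiv P := m⁻¹ · L(m • P)` (`m • P ∈ E⁽²⁾` always, `AddSubgroup.nsmul_index_mem`), which is
PROVED here to be additive on all of `E(ℚ₂)`, to agree with `L` on `E⁽²⁾(ℚ₂)`, and to vanish exactly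
on the torsion (when `m ≠ 0`). Nothing downstream used the §1 slot (`O1.KatoHTwoBoundAtTwo` of
`TwoAdicKatoHTwo.lean` carries `c₂` directly); the §2 theorems are unaffected. -/

section Div

variable (V : WeierstrassCurve ℚ_[2]) [V.IsIntegral ℤ_[2]] [V.IsElliptic]

/-- **The `2`-adic Néron logarithm extended by division**: `log P := m⁻¹ · L(m • P)` with
`m = [E(ℚ₂) : E⁽²⁾(ℚ₂)]` (`AddSubgroup.index`, junk `0` if infinite — it is finite for a minimal
model, `index_formalFiltration`) and `L = padicLimitLog` the limit logarithm, which converges on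
`E⁽²⁾(ℚ₂) ∋ m • P`. Independent of the choice of the multiplier by `padicLogDiv_of_mem` and
additivity. [cite: SilvermanAEC2009, IV.6.4 (b) and VII.6.3] -/
def padicLogDiv (P : V.toAffine.Point) : ℚ_[2] :=
  (((V.formalFiltration 2).index : ℕ) : ℚ_[2])⁻¹ *
    V.padicLimitLog ((V.formalFiltration 2).index • P)

/-- The defining formula. -/
theorem padicLogDiv_def (P : V.toAffine.Point) : padicLogDiv V P =
    (((V.formalFiltration 2).index : ℕ) : ℚ_[2])⁻¹ *
      V.padicLimitLog ((V.formalFiltration 2).index • P) := rfl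

/-- `m • P ∈ E⁽²⁾(ℚ₂)` for every `P`, `m = [E(ℚ₂) : E⁽²⁾(ℚ₂)]`. -/
theorem index_nsmul_mem_formalFiltration_two (P : V.toAffine.Point) :
    (V.formalFiltration 2).index • P ∈ V.formalFiltration 2 :=
  AddSubgroup.nsmul_index_mem _ P

/-- `L(j • P) = j · L(P)` on `E⁽²⁾(ℚ₂)` (additivity of the limit logarithm, iterated). -/
theorem padicLimitLog_nsmul_of_mem_two {P : V.toAffine.Point} (hP : P ∈ V.formalFiltration 2)
    (j : ℕ) : V.padicLimitLog (j • P) = j * V.padicLimitLog P := by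
  induction j with
  | zero => rw [zero_nsmul, V.padicLimitLog_zero, Nat.cast_zero, zero_mul]
  | succ j ih =>
    rw [succ_nsmul, V.padicLimitLog_add_of_mem le_rfl (AddSubgroup.nsmul_mem _ hP j) hP, ih,
      Nat.cast_succ]
    ring

/-- `log 0 = 0`. -/
@[simp] theorem padicLogDiv_zero : padicLogDiv V 0 = 0 := by
  rw [padicLogDiv_def, nsmul_zero, V.padicLimitLog_zero, mul_zero]

/-- **Additivity on ALL of `E(ℚ₂)`**: `log(P + Q) = log P + log Q`. -/
theorem padicLogDiv_add (P Q : V.toAffine.Point) :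
    padicLogDiv V (P + Q) = padicLogDiv V P + padicLogDiv V Q := by
  rw [padicLogDiv_def, padicLogDiv_def, padicLogDiv_def, nsmul_add,
    V.padicLimitLog_add_of_mem le_rfl (index_nsmul_mem_formalFiltration_two V P)
      (index_nsmul_mem_formalFiltration_two V Q), mul_add]

/-- `log(−P) = −log P`. -/
theorem padicLogDiv_neg (P : V.toAffine.Point) : padicLogDiv V (-P) = -padicLogDiv V P := by
  have h := padicLogDiv_add V (-P) P
  rw [neg_add_cancel, padicLogDiv_zero] at h
  linear_combination -h

/-- `log(j • P) = j · log P`. -/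
theorem padicLogDiv_nsmul (P : V.toAffine.Point) (j : ℕ) :
    padicLogDiv V (j • P) = j * padicLogDiv V P := by
  induction j with
  | zero => rw [zero_nsmul, padicLogDiv_zero, Nat.cast_zero, zero_mul]
  | succ j ih => rw [succ_nsmul, padicLogDiv_add, ih, Nat.cast_succ]; ring

/-- **Agreement with the limit logarithm on `E⁽²⁾(ℚ₂)`** (when the index `m` is finite, i.e.
`m ≠ 0`): `log P = L(P)` for `P ∈ E⁽²⁾(ℚ₂)`. -/
theorem padicLogDiv_of_mem (hm : (V.formalFiltration 2).index ≠ 0) {P : V.toAffine.Point}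
    (hP : P ∈ V.formalFiltration 2) : padicLogDiv V P = V.padicLimitLog P := by
  rw [padicLogDiv_def, padicLimitLog_nsmul_of_mem_two V hP, ← mul_assoc,
    inv_mul_cancel₀ (Nat.cast_ne_zero.mpr hm), one_mul]

/-- More generally `log P = j⁻¹ · L(j • P)` for ANY `j ≠ 0` with `j • P ∈ E⁽²⁾(ℚ₂)` (the
extension by division does not depend on the multiplier). -/
theorem padicLogDiv_eq_of_nsmul_mem (hm : (V.formalFiltration 2).index ≠ 0) {P : V.toAffine.Point}
    {j : ℕ} (hj : j ≠ 0) (hjP : j • P ∈ V.formalFiltration 2) :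
    padicLogDiv V P = ((j : ℕ) : ℚ_[2])⁻¹ * V.padicLimitLog (j • P) := by
  rw [← padicLogDiv_of_mem V hm hjP, padicLogDiv_nsmul, ← mul_assoc,
    inv_mul_cancel₀ (Nat.cast_ne_zero.mpr hj), one_mul]

/-- **The kernel is the torsion** (finite index `m ≠ 0`): `log P = 0 ↔ P` has finite order. -/
theorem padicLogDiv_eq_zero_iff (hm : (V.formalFiltration 2).index ≠ 0) (P : V.toAffine.Point) :
    padicLogDiv V P = 0 ↔ IsOfFinAddOrder P := by
  constructor
  · intro h
    rw [padicLogDiv_def, mul_eq_zero, inv_eq_zero, Nat.cast_eq_zero] at h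
    have h0 : V.padicLimitLog ((V.formalFiltration 2).index • P) = 0 := h.resolve_left hm
    have hP0 := V.eq_zero_of_padicLimitLog_eq_zero le_rfl (index_nsmul_mem_formalFiltration_two V P) h0
    exact isOfFinAddOrder_iff_nsmul_eq_zero.mpr ⟨_, Nat.pos_of_ne_zero hm, hP0⟩
  · intro h
    obtain ⟨k, hk, hkP⟩ := isOfFinAddOrder_iff_nsmul_eq_zero.mp h
    have h1 : (k : ℚ_[2]) * padicLogDiv V P = 0 := by
      rw [← padicLogDiv_nsmul, hkP, padicLogDiv_zero]
    exact (mul_eq_zero.mp h1).resolve_left (Nat.cast_ne_zero.mpr hk.ne')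

end Div

/-- **LEMMA ι (ι-E), RE-TYPED with the logarithm extended by division** (register name
`localIndexAtTwo_eq`; PROVABLE, NOT asserted): with `W₂ = W.map (algebraMap ℚ ℚ_[2])` (`ℤ₂`-minimal)
and `log = padicLogDiv W₂` (`= log_ω` on all of `E(ℚ₂)`), every `P ∈ E(ℚ₂)` has
`‖log P‖₂ ≤ 2^{−e(W)}` with equality for some `P`, `e(W) = 1 + t₂ − v₂(c₂) − v₂(#Ẽ_ns(𝔽₂))`
(`localLogIndexExponentAtTwo`). Proof route (unwritten, all inputs in the tree): `log` is a
homomorphism `E(ℚ₂) → ℚ₂` with kernel `E(ℚ₂)_tors` (`padicLogDiv_add`, `padicLogDiv_eq_zero_iff`)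
restricting to `L : E⁽²⁾(ℚ₂) ≅ 4ℤ₂` (`exists_mem_padicLimitLog_eq`, `norm_padicLimitLog_of_mem`),
and `[E(ℚ₂) : E⁽²⁾(ℚ₂)] = 2·c₂·#Ẽ_ns(𝔽₂)` (`WeierstrassCurve.index_formalFiltration`), so
`[log E(ℚ₂) : 4ℤ₂] = 2c₂#Ẽ_ns(𝔽₂)/#E(ℚ₂)_tors`. This replaces the §1 slot `LocalLogIndexAtTwo`
(ill-posed off the `2`-power part of `E/E⁽²⁾`, see the §3 note).
[cite: SilvermanAEC2009, IV.6.4 (b), VII.2.1–2.2 and C.15–C.16] [cite: Kato2004Asterisque, Prop. 14.16–14.18] -/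
def LocalLogDivIndexAtTwo : Prop :=
  haveI := isMinimal_map_padic_of_isGloballyMinimal W 2
  (∀ P : (W.map (algebraMap ℚ ℚ_[2])).toAffine.Point,
      ‖padicLogDiv (W.map (algebraMap ℚ ℚ_[2])) P‖ ≤ (2 : ℝ) ^ (-localLogIndexExponentAtTwo W)) ∧
  ∃ P : (W.map (algebraMap ℚ ℚ_[2])).toAffine.Point,
      ‖padicLogDiv (W.map (algebraMap ℚ ℚ_[2])) P‖ = (2 : ℝ) ^ (-localLogIndexExponentAtTwo W)

/-- The re-typed slot still sees the bottom rung: `LocalLogDivIndexAtTwo W → e(W) ≤ 2`, provided the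
index `[E(ℚ₂) : E⁽²⁾(ℚ₂)]` is finite (it is: `index_formalFiltration`; kept as a hypothesis to stay
inside this file's imports). [cite: SilvermanAEC2009, IV.6.4 (b) and VII.6.3] -/
theorem localLogIndexExponentAtTwo_le_two_of_div
    (hm : haveI := isMinimal_map_padic_of_isGloballyMinimal W 2
      ((W.map (algebraMap ℚ ℚ_[2])).formalFiltration 2).index ≠ 0)
    (h : LocalLogDivIndexAtTwo W) : localLogIndexExponentAtTwo W ≤ 2 := by
  haveI := isMinimal_map_padic_of_isGloballyMinimal W 2
  obtain ⟨P, hP, hPn⟩ :=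
    exists_mem_formalFiltration_two_norm_padicLimitLog_eq (W.map (algebraMap ℚ ℚ_[2]))
  have hle := h.1 P
  rw [padicLogDiv_of_mem _ hm hP, hPn] at hle
  by_contra hlt
  have hlt' : 2 < localLogIndexExponentAtTwo W := not_le.mp hlt
  have : (2 : ℝ) ^ (-localLogIndexExponentAtTwo W) < (2 : ℝ) ^ (-(2 : ℤ)) :=
    zpow_lt_zpow_right₀ (by norm_num) (by omega)
  exact absurd hle (not_le.mpr this)

end Summit.BirchSwinnertonDyer.Rank1Residual.X5.O1

end
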